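import Mathlib.Analysis.Analytic.IteratedFDeriv
import Mathlib.Analysis.Analytic.ChangeOrigin
import Mathlib.Analysis.SpecificLimits.Normed
import Mathlib.Data.Fintype.Powerset
import HarnessLib

/-!
# Cauchy estimates for real- (and complex-) analytic maps of several variables

The necessity half of the characterisation of analytic functions by factorial derivative bounds
(Krantz–Parks, *A Primer of Real Analytic Functions*, 2nd ed., Prop. 2.2.10; for one complex
variable these are Cauchy's inequalities): if `f` has a power series `p` on a ball about `x` with
`‖pₙ‖ ≤ C ρ⁻ⁿ`, then on the ball of radius `ρ/2` about `x`

  `‖Dᵏ f(x + y)‖ ≤ 2C (2/ρ)ᵏ k!`,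

so every analytic map satisfies locally uniform bounds `‖Dᵏ f‖ ≤ M Cᵏ k!` — the hypothesis of
the converse `Literature.Analysis.Calculus.analyticOnNhd_of_locally_norm_iteratedFDeriv_le`
(`AnalyticOfFDerivBound.lean`). Such bounds for the (analytic) coefficient functions are the input
of the majorant bookkeeping in the proofs that solutions of analytic elliptic systems are analytic
(Morrey 1958, Friedman 1958; towards `Literature.Geometry.Lorentzian.mullerZumHagen1970_analytic_of_timelikeKilling`).
Proof: Mathlib knows that `Dᵏ f` has the power series `p.iteratedFDerivSeries k`
(`HasFPowerSeriesWithinOnBall.iteratedFDerivWithin`); we bound its coefficients,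
`‖p.iteratedFDerivSeries k n‖ ≤ (n + k)!/n! ‖p (n + k)‖` (`norm_iteratedFDerivSeries_le`, from
`‖p.derivSeries n‖ ≤ (n + 1) ‖p (n + 1)‖`, `norm_derivSeries_le`), and sum the binomial series
`∑ₙ C(n + k, k) qⁿ = (1 − q)^{-(k+1)}` (Mathlib's `hasSum_choose_mul_geometric_of_norm_lt_one`).

* `FormalMultilinearSeries.norm_derivSeries_le`, `FormalMultilinearSeries.norm_iteratedFDerivSeries_le`;
* `norm_iteratedFDeriv_le_of_hasFPowerSeriesOnBall` — the Cauchy estimate above;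
* `AnalyticAt.exists_ball_norm_iteratedFDeriv_le` — locally uniform factorial bounds.

Everything is proved; no definitions, no named facts.

## References

* S. G. Krantz, H. R. Parks, *A Primer of Real Analytic Functions*, 2nd ed. (2002), Prop. 2.2.10.
  [KrantzParks2002]
-/

open Set Filter Metric
open scoped Topology NNReal ENNReal Nat

noncomputable section

namespace Literature.Analysis.Calculus

variable {𝕜 : Type*} [NontriviallyNormedField 𝕜] {E F : Type*} [NormedAddCommGroup E]
  [NormedSpace 𝕜 E] [NormedAddCommGroup F] [NormedSpace 𝕜 F]

/-! ### Coefficient bounds for the derivative series -/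

/-- The operator norm of (the continuous linear map underlying) a linear isometry equivalence is
at most `1`. [folklore] -/
private theorem norm_toContinuousLinearMap_le_one {G G' : Type*} [NormedAddCommGroup G]
    [NormedSpace 𝕜 G] [NormedAddCommGroup G'] [NormedSpace 𝕜 G'] (A : G ≃ₗᵢ[𝕜] G') :
    ‖(A.toContinuousLinearEquiv : G →L[𝕜] G')‖ ≤ 1 :=
  ContinuousLinearMap.opNorm_le_bound _ zero_le_one fun x ↦ by simp

/-- **Coefficients of the derivative series**: `‖p.derivSeries n‖ ≤ (n + 1) ‖p (n + 1)‖`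
(the `n`-th coefficient of the derivative series is a sum of `n + 1` curried copies of
`p (n + 1)`). [folklore] -/
theorem _root_.FormalMultilinearSeries.norm_derivSeries_le (p : FormalMultilinearSeries 𝕜 E F)
    (n : ℕ) : ‖p.derivSeries n‖ ≤ (n + 1) * ‖p (n + 1)‖ := by
  have h1 : ‖p.derivSeries n‖ ≤ ‖p.changeOriginSeries 1 n‖ := by
    refine (ContinuousLinearMap.norm_compContinuousMultilinearMap_le _ _).trans ?_
    refine mul_le_of_le_one_left (norm_nonneg _) ?_
    exact ContinuousLinearMap.opNorm_le_bound _ zero_le_one (by simp)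
  have h2 : ‖p.changeOriginSeries 1 n‖ ≤
      (Fintype.card {s : Finset (Fin (1 + n)) // s.card = n} : ℝ) * ‖p (1 + n)‖ := by
    have h := p.nnnorm_changeOriginSeries_le_tsum 1 n
    rw [tsum_fintype, Finset.sum_const, Finset.card_univ, nsmul_eq_mul] at h
    exact_mod_cast h
  have hcard : Fintype.card {s : Finset (Fin (1 + n)) // s.card = n} = n + 1 := by
    rw [Fintype.card_finset_len, Fintype.card_fin, Nat.add_comm, Nat.choose_succ_self_right]
  rw [hcard, Nat.add_comm 1 n] at h2
  refine h1.trans (h2.trans (le_of_eq ?_))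
  push_cast
  ring

set_option maxSynthPendingDepth 3 in
/-- **Coefficients of the series of the iterated derivative**:
`‖p.iteratedFDerivSeries k n‖ ≤ ((n + k)!/n!) ‖p (n + k)‖` (Mathlib's
`FormalMultilinearSeries.iteratedFDerivSeries`, the power series of `Dᵏ f` for `f` with power
series `p`; induction on `k` with `norm_derivSeries_le`, the curryings being isometries).
[folklore] -/
theorem _root_.FormalMultilinearSeries.norm_iteratedFDerivSeries_le
    (p : FormalMultilinearSeries 𝕜 E F) (k n : ℕ) :
    ‖p.iteratedFDerivSeries k n‖ ≤ ((n + k)! : ℝ) / n ! * ‖p (n + k)‖ := by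
  induction k generalizing n with
  | zero =>
    have hle : ‖p.iteratedFDerivSeries 0 n‖ ≤ ‖p n‖ := by
      refine ContinuousMultilinearMap.opNorm_le_bound (norm_nonneg _) fun v ↦ ?_
      have key : ‖p.iteratedFDerivSeries 0 n v‖ = ‖p n v‖ := by
        simp only [FormalMultilinearSeries.iteratedFDerivSeries,
          ContinuousLinearMap.compFormalMultilinearSeries_apply,
          ContinuousLinearMap.compContinuousMultilinearMap_coe, ContinuousLinearEquiv.coe_coe,
          LinearIsometryEquiv.coe_toContinuousLinearEquiv, Function.comp_apply,
          LinearIsometryEquiv.norm_map]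
      rw [key]
      exact (p n).le_opNorm v
    have hn : (n ! : ℝ) ≠ 0 := by exact_mod_cast (Nat.factorial_pos n).ne'
    have h1 : ((n + 0)! : ℝ) / n ! = 1 := by rw [Nat.add_zero]; exact div_self hn
    rw [h1, one_mul]
    exact hle
  | succ k ih =>
    have hle : ‖p.iteratedFDerivSeries (k + 1) n‖ ≤ ‖(p.iteratedFDerivSeries k).derivSeries n‖ := by
      refine ContinuousMultilinearMap.opNorm_le_bound
        (norm_nonneg ((p.iteratedFDerivSeries k).derivSeries n)) fun v ↦ ?_
      have key : ‖p.iteratedFDerivSeries (k + 1) n v‖ =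
          ‖(p.iteratedFDerivSeries k).derivSeries n v‖ := by
        simp only [FormalMultilinearSeries.iteratedFDerivSeries,
          ContinuousLinearMap.compFormalMultilinearSeries_apply,
          ContinuousLinearMap.compContinuousMultilinearMap_coe, ContinuousLinearEquiv.coe_coe,
          LinearIsometryEquiv.coe_toContinuousLinearEquiv, Function.comp_apply,
          LinearIsometryEquiv.norm_map]
      rw [key]
      exact ((p.iteratedFDerivSeries k).derivSeries n).le_opNorm v
    refine hle.trans (((p.iteratedFDerivSeries k).norm_derivSeries_le n).trans ?_)
    have h := ih (n + 1)
    have hnk : n + 1 + k = n + (k + 1) := by omega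
    rw [hnk] at h
    have hn : (0 : ℝ) < n ! := by exact_mod_cast Nat.factorial_pos n
    have hn1 : ((n + 1)! : ℝ) = (n + 1) * n ! := by push_cast [Nat.factorial_succ]; ring
    calc ((n : ℝ) + 1) * ‖p.iteratedFDerivSeries k (n + 1)‖
        ≤ ((n : ℝ) + 1) * (((n + (k + 1))! : ℝ) / (n + 1)! * ‖p (n + (k + 1))‖) := by
          gcongr
      _ = ((n + (k + 1))! : ℝ) / n ! * ‖p (n + (k + 1))‖ := by
          rw [hn1]
          field_simp

/-! ### The Cauchy estimate -/

/-- `(n + k)!/n! = k! C(n + k, k)`. [folklore] -/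
private theorem factorial_add_div (n k : ℕ) :
    ((n + k)! : ℝ) / n ! = k ! * ((n + k).choose k : ℝ) := by
  have hn : (n ! : ℝ) ≠ 0 := by exact_mod_cast (Nat.factorial_pos n).ne'
  rw [div_eq_iff hn]
  have h := Nat.choose_mul_factorial_mul_factorial (Nat.le_add_left k n)
  rw [Nat.add_sub_cancel] at h
  have h' : ((n + k).choose k : ℝ) * k ! * n ! = (n + k)! := by exact_mod_cast h
  rw [← h']
  ring

/-- **Cauchy estimate for the derivatives of an analytic map** (Krantz–Parks 2002, Prop. 2.2.10,
necessity; Cauchy's inequalities): if `f` has the power series `p` on the ball of radius `r` about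
`x` (`F` complete) and `‖pₙ‖ ≤ C ρ⁻ⁿ` for some `0 < ρ ≤ r`, then for `‖y‖ ≤ ρ / 2` and every `k`,
`‖Dᵏ f(x + y)‖ ≤ 2 C (2/ρ)ᵏ k!`. Proof: `Dᵏ f(x + y) = ∑ₙ (p.iteratedFDerivSeries k n)(y, …, y)`
with `‖p.iteratedFDerivSeries k n‖ ≤ k! C(n+k, k) ‖p (n + k)‖ ≤ k! C(n+k,k) C ρ^{-(n+k)}`, and
`∑ₙ C(n + k, k) qⁿ = (1 − q)^{-(k+1)} ≤ 2^{k+1}` for `q = ‖y‖/ρ ≤ 1/2`.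
[cite: KrantzParks2002, Prop. 2.2.10] -/
theorem norm_iteratedFDeriv_le_of_hasFPowerSeriesOnBall [CompleteSpace F] {f : E → F}
    {p : FormalMultilinearSeries 𝕜 E F} {x : E} {r : ℝ≥0∞} (hf : HasFPowerSeriesOnBall f p x r)
    {C ρ : ℝ} (hρ : 0 < ρ) (hρr : ENNReal.ofReal ρ ≤ r) (hC : ∀ n, ‖p n‖ ≤ C / ρ ^ n) {y : E}
    (hy : ‖y‖ ≤ ρ / 2) (k : ℕ) :
    ‖iteratedFDeriv 𝕜 k f (x + y)‖ ≤ 2 * C * (2 / ρ) ^ k * k ! := by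
  have hC0 : 0 ≤ C := by simpa using (norm_nonneg _).trans (hC 0)
  -- the power series of `Dᵏ f` on the ball
  set s : Set E := eball x r with hs
  have hso : IsOpen s := isOpen_eball
  have hxs : x ∈ s := mem_eball_self hf.r_pos
  have hq := hf.hasFPowerSeriesWithinOnBall.iteratedFDerivWithin (s := s)
    hf.analyticOnNhd.analyticOn k hso.uniqueDiffOn hxs
  -- `y` is in the ball
  have hyρ : ‖y‖ < ρ := hy.trans_lt (by linarith)
  have hye : (‖y‖ₑ : ℝ≥0∞) < r := by
    rw [← ofReal_norm]
    exact ((ENNReal.ofReal_lt_ofReal_iff hρ).2 hyρ).trans_le hρr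
  have hy_ball : y ∈ eball (0 : E) r := by rwa [mem_eball, edist_zero_right]
  have hxy : x + y ∈ s := by
    rw [hs, mem_eball, edist_eq_enorm_sub, add_sub_cancel_left]
    exact hye
  have hsum := hq.hasSum (y := y) (mem_insert_of_mem _ hxy) hy_ball
  rw [iteratedFDerivWithin_of_isOpen k hso hxy] at hsum
  -- termwise bound
  set q : ℝ := ‖y‖ / ρ with hq_def
  have hq0 : 0 ≤ q := by positivity
  have hq1 : q ≤ 1 / 2 := by rw [hq_def, div_le_iff₀ hρ]; linarith
  have hq1' : ‖q‖ < 1 := by rw [Real.norm_eq_abs, abs_of_nonneg hq0]; linarith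
  have hterm : ∀ n, ‖p.iteratedFDerivSeries k n fun _ ↦ y‖ ≤
      C * k ! / ρ ^ k * (((n + k).choose k : ℝ) * q ^ n) := by
    intro n
    calc ‖p.iteratedFDerivSeries k n fun _ ↦ y‖
        ≤ ‖p.iteratedFDerivSeries k n‖ * ∏ _i : Fin n, ‖y‖ :=
          ContinuousMultilinearMap.le_opNorm _ _
      _ ≤ ((n + k)! : ℝ) / n ! * ‖p (n + k)‖ * ‖y‖ ^ n := by
          rw [Finset.prod_const, Finset.card_univ, Fintype.card_fin]
          gcongr
          exact p.norm_iteratedFDerivSeries_le k n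
      _ ≤ ((n + k)! : ℝ) / n ! * (C / ρ ^ (n + k)) * ‖y‖ ^ n := by
          gcongr
          exact hC (n + k)
      _ = C * k ! / ρ ^ k * (((n + k).choose k : ℝ) * q ^ n) := by
          rw [factorial_add_div, hq_def, div_pow, pow_add]
          field_simp
  -- sum the binomial series
  have hbin := (hasSum_choose_mul_geometric_of_norm_lt_one k hq1').mul_left (C * k ! / ρ ^ k)
  have hle := hsum.norm_le_of_bounded hbin hterm
  refine hle.trans ?_
  -- `1 / (1 - q)^(k+1) ≤ 2^(k+1)`
  have hgeom : 1 / (1 - q) ^ (k + 1) ≤ 2 ^ (k + 1) := by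
    rw [div_le_iff₀ (by apply pow_pos; linarith), ← mul_pow]
    have h2 : (1 : ℝ) ≤ 2 * (1 - q) := by linarith
    exact one_le_pow₀ h2
  calc C * k ! / ρ ^ k * (1 / (1 - q) ^ (k + 1)) ≤ C * k ! / ρ ^ k * 2 ^ (k + 1) := by
        gcongr
    _ = 2 * C * (2 / ρ) ^ k * k ! := by
        rw [div_pow, pow_succ]
        field_simp

/-- **Analytic maps satisfy locally uniform factorial derivative bounds** (Krantz–Parks 2002,
Prop. 2.2.10, necessity): if `f` is analytic at `x` (`F` complete) then there are `δ > 0` and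
constants `M`, `C` with `‖Dᵏ f(z)‖ ≤ M Cᵏ k!` for all `k` and all `z ∈ ball x δ` — the hypothesis
shape of the converse `analyticOnNhd_of_locally_norm_iteratedFDeriv_le`.
[cite: KrantzParks2002, Prop. 2.2.10] -/
theorem _root_.AnalyticAt.exists_ball_norm_iteratedFDeriv_le [CompleteSpace F] {f : E → F}
    {x : E} (hf : AnalyticAt 𝕜 f x) :
    ∃ δ > (0 : ℝ), ∃ M C : ℝ, 0 ≤ M ∧ 0 ≤ C ∧
      ∀ z ∈ ball x δ, ∀ k : ℕ, ‖iteratedFDeriv 𝕜 k f z‖ ≤ M * C ^ k * k ! := by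
  obtain ⟨p, r, hp⟩ := hf
  -- a positive real radius `ρ₀ < r` inside the radius of convergence
  obtain ⟨ρ₀, hρ₀0, hρ₀r⟩ := ENNReal.lt_iff_exists_nnreal_btwn.1 hp.r_pos
  have hρ₀0' : 0 < ρ₀ := by exact_mod_cast hρ₀0
  have hρ₀rad : (ρ₀ : ℝ≥0∞) < p.radius := hρ₀r.trans_le hp.r_le
  obtain ⟨C, hC0, hC⟩ := p.norm_le_div_pow_of_pos_of_lt_radius hρ₀0' hρ₀rad
  set ρ : ℝ := (ρ₀ : ℝ) with hρ
  have hρ0 : 0 < ρ := by rw [hρ]; exact_mod_cast hρ₀0'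
  have hρr : ENNReal.ofReal ρ ≤ r := by
    rw [hρ, ENNReal.ofReal_coe_nnreal]
    exact hρ₀r.le
  refine ⟨ρ / 2, by positivity, 2 * C, 2 / ρ, by positivity, by positivity, fun z hz k ↦ ?_⟩
  have hy : ‖z - x‖ ≤ ρ / 2 := by
    rw [mem_ball, dist_eq_norm] at hz
    exact hz.le
  have h := norm_iteratedFDeriv_le_of_hasFPowerSeriesOnBall hp hρ0 hρr hC hy k
  rwa [add_sub_cancel] at h

/-- **Analytic maps satisfy locally uniform factorial derivative bounds**, `AnalyticOnNhd` form:
on an open set where `f` is analytic, every point has a ball on which `‖Dᵏ f‖ ≤ M Cᵏ k!`.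
[cite: KrantzParks2002, Prop. 2.2.10] -/
theorem _root_.AnalyticOnNhd.exists_ball_norm_iteratedFDeriv_le [CompleteSpace F] {f : E → F}
    {U : Set E} (hf : AnalyticOnNhd 𝕜 f U) {x : E} (hx : x ∈ U) :
    ∃ δ > (0 : ℝ), ∃ M C : ℝ, 0 ≤ M ∧ 0 ≤ C ∧
      ∀ z ∈ ball x δ, ∀ k : ℕ, ‖iteratedFDeriv 𝕜 k f z‖ ≤ M * C ^ k * k ! :=
  (hf x hx).exists_ball_norm_iteratedFDeriv_le

end Literature.Analysis.Calculus
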